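import Literature.NumberTheory.Automorphic.ArthurClozelBaseChange
import HarnessLib

/-!
# `σ`-stability under a generator of `Gal(E/F)` (Arthur–Clozel, Ch. 3, Thm. 4.2 (d); proof file)

Topic `NumberTheory/Automorphic`; namespace `Literature.NumberTheory.Automorphic`. Sibling proof
file of `AutomorphicGaloisConj` (Galois conjugates `U_σ(Π)` of cuspidal automorphic
representations of `GL_n(𝔸_E)`, `IsGalStable`, and the named fact
`ArthurClozel1989_exists_cuspidal_descent_of_isGalStable`), importing `ArthurClozelBaseChange` for
the `η`-refined statements it reduces to. Everything here is **proved**; no new definition, no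
named fact, no new instance.

Arthur–Clozel state Thm. 4.2 (d) of Ch. 3 for a cuspidal `Π` with "`Π ≅ Π ∘ σ`", `σ` a (fixed)
generator of `Gal(E/F)`, `E/F` cyclic of prime degree `ℓ` (held copy, PDF chunk 173: "(d) Assume
`Π` is cuspidal, `Π ≅ Π ∘ σ`. Then there is `π` cuspidal lifting to `Π`"), whereas the tree's
rendering `ArthurClozel1989_exists_cuspidal_descent_of_isGalStable` asks for stability under
*every* `σ ∈ Gal(E/F)` (the convention-independent form, `U_σ(Π) ≅ Π ∘ σ⁻¹`). This file supplies
the bridge its docstring promises ("for prime degree equivalent to stability under a generator"):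

* `CuspidalAutomorphicRepGL.isGalStable_pow`, `isGalStable_inv`, `isGalStable_zpow`,
  `isGalStable_of_mem_zpowers` — the stabiliser `{σ | U_σ(Π) = Π}` is a subgroup (from the action
  laws `isGalStable_one`, `isGalStable_mul` of `AutomorphicGaloisConj`);
* `CuspidalAutomorphicRepGL.forall_isGalStable_of_prime` — for `E/F` Galois of prime degree,
  stability under one `σ ≠ 1` is stability under all of `Gal(E/F)` (a group of prime order is
  generated by any non-trivial element, Mathlib `mem_powers_of_prime_card` with
  `IsGalois.card_aut_eq_finrank`);
* `ArthurClozel1989_exists_cuspidal_descent_of_isGalStable.of_generator` — the named fact in its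
  printed form: granted the fact, a cuspidal `Π` on `GL_n(𝔸_E)` stable under a single non-trivial
  `σ ∈ Gal(E/F)` (`E/F` Galois of prime degree, so `σ` generates) is a weak base-change lift of a
  cuspidal `π` on `GL_n(𝔸_F)`.
* the degenerate rank `n = 0` (outside the printed range `G = GL(n)`, `n ≥ 1`, but inside the
  tree's rendering, which quantifies over all `n`): `GL_0(𝔸_K)` is trivial, its automorphic quotient
  is one point (a private copy of `subsingleton_automorphicQuotient_gl_zero` of
  `StrongMultiplicityOneRankinSelberg`, to keep the imports light), the Dirac mass there is an
  automorphic measure (`isAutomorphicMeasure_dirac_gl_zero`), `L²` is a line and is itself a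
  cuspidal automorphic representation (`nonempty_cuspidalAutomorphicRepGL_zero`: `L²_cusp = L²` is
  irreducible), and relation (1.1) is empty (`isWeakBaseChangeLift_of_rank_zero`: Satake parameters
  have `0` entries); hence `arthurClozel1989_exists_cuspidal_descent_of_isGalStable_zero`, the fact
  at `n = 0`, **proved**;
* `arthurClozel1989_exists_cuspidal_descent_of_isGalStable_of_descent'` — for *every* `n`, the fact
  follows from its `η`-refined form `ArthurClozel1989_cuspidal_descent` (Thm. 4.2 (d) in full,
  `n ≥ 1`) and class field theory (`exists_isClassFieldCharacter`), combining the case `n = 0` with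
  the reduction `arthurClozel1989_exists_cuspidal_descent_of_isGalStable_of_descent` of
  `ArthurClozelBaseChange` (which needs `0 < n`): the `η`-free fact is not an independent leaf.

Triage note (provefact unit of `ArthurClozel1989_exists_cuspidal_descent_of_isGalStable`, sized
XL): the printed proof of Thm. 4.2 (d) (PDF chunks 174–177) extracts `π` from the identity
(4.1) = (4.2) of the discrete parts of the trace formulas of `GL(n)_F` and `GL(n)_E ⋊ σ` (Ch. 2,
(17.8), Thms. A–B), then proves `π` cuspidal with the Jacquet–Shalika results (2.1)–(2.4),
Lemma 4.3, Thm. 3.1 and Thm. 4.2 (a), (b), (e) for smaller ranks (Langlands' description of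
automorphic representations as subquotients of representations induced from cuspidal); the
trace-formula side and parabolic induction have no counterpart on the present tree, so the fact
stays a named fact (its `η`-refined form is `ArthurClozel1989_cuspidal_descent` of
`ArthurClozelBaseChange`, with the proved projection
`arthurClozel1989_exists_cuspidal_descent_of_isGalStable_of_descent`).

## References

* J. Arthur, L. Clozel, *Simple algebras, base change, and the advanced theory of the trace
  formula*, Ann. of Math. Stud. 120 (1989), Ch. 1 §2.1 (`Π^σ`, `σ`-stable); Ch. 3, §4,
  Thm. 4.2 (d) (book p. 203; held copy
  `book:arthur1989-simple-algebras-base-change-advanced-theory-trace`, PDF chunks 173, 177).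
  [ArthurClozelAMS120]
-/

noncomputable section

namespace Literature.NumberTheory.Automorphic

open NumberField MeasureTheory AdelicGroupData

/-! ### The stabiliser of `Π` in `Aut(E/F)` is a subgroup -/

section Stabiliser

variable (F : Type*) [Field F] {E : Type} [Field E] [NumberField E] [Algebra F E] {n : ℕ}
  {μ : Measure (gl n E).automorphicQuotient}
  [SMulInvariantMeasure (gl n E).Adelic (gl n E).automorphicQuotient μ]

/-- `Π` `σ`-stable ⇒ `Π` `σᵏ`-stable (`k : ℕ`): the stabiliser is closed under products
(`isGalStable_one`, `isGalStable_mul`). [folklore] -/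
theorem CuspidalAutomorphicRepGL.isGalStable_pow {P : CuspidalAutomorphicRepGL n E μ}
    {hμ : IsGalInvariant F μ} {σ : E ≃ₐ[F] E} (h : P.IsGalStable F hμ σ) (k : ℕ) :
    P.IsGalStable F hμ (σ ^ k) := by
  induction k with
  | zero => simpa only [pow_zero] using P.isGalStable_one F hμ
  | succ k ih => simpa only [pow_succ] using CuspidalAutomorphicRepGL.isGalStable_mul F ih h

/-- `Π` `σ`-stable ⇒ `Π` `σ⁻¹`-stable: apply `U_{σ⁻¹}` to `U_σ(Π) = Π` (`galConj_galConj`,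
`galConj_one`). [folklore] -/
theorem CuspidalAutomorphicRepGL.isGalStable_inv {P : CuspidalAutomorphicRepGL n E μ}
    {hμ : IsGalInvariant F μ} {σ : E ≃ₐ[F] E} (h : P.IsGalStable F hμ σ) :
    P.IsGalStable F hμ σ⁻¹ := by
  unfold CuspidalAutomorphicRepGL.IsGalStable at h ⊢
  conv_lhs => rw [← h]
  rw [P.galConj_galConj F hμ σ⁻¹ σ, inv_mul_cancel, P.galConj_one F hμ]

/-- `Π` `σ`-stable ⇒ `Π` `σᵏ`-stable (`k : ℤ`). [folklore] -/
theorem CuspidalAutomorphicRepGL.isGalStable_zpow {P : CuspidalAutomorphicRepGL n E μ}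
    {hμ : IsGalInvariant F μ} {σ : E ≃ₐ[F] E} (h : P.IsGalStable F hμ σ) (k : ℤ) :
    P.IsGalStable F hμ (σ ^ k) := by
  cases k with
  | ofNat k =>
    simpa only [Int.ofNat_eq_natCast, zpow_natCast] using
      CuspidalAutomorphicRepGL.isGalStable_pow F h k
  | negSucc k =>
    simpa only [zpow_negSucc] using CuspidalAutomorphicRepGL.isGalStable_inv F
      (CuspidalAutomorphicRepGL.isGalStable_pow F h (k + 1))

/-- `Π` `σ`-stable ⇒ `Π` `τ`-stable for every `τ` in the cyclic subgroup generated by `σ`.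
[folklore] -/
theorem CuspidalAutomorphicRepGL.isGalStable_of_mem_zpowers {P : CuspidalAutomorphicRepGL n E μ}
    {hμ : IsGalInvariant F μ} {σ τ : E ≃ₐ[F] E} (h : P.IsGalStable F hμ σ)
    (hτ : τ ∈ Subgroup.zpowers σ) : P.IsGalStable F hμ τ := by
  obtain ⟨k, rfl⟩ := Subgroup.mem_zpowers_iff.mp hτ
  exact CuspidalAutomorphicRepGL.isGalStable_zpow F h k

end Stabiliser

/-! ### Prime degree: one non-trivial `σ` suffices -/

section PrimeDegree

variable (F : Type) [Field F] {E : Type} [Field E] [NumberField E] [Algebra F E] {n : ℕ}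
  {μ : Measure (gl n E).automorphicQuotient}
  [SMulInvariantMeasure (gl n E).Adelic (gl n E).automorphicQuotient μ]

/-- **For `E/F` Galois of prime degree, stability under one non-trivial `σ` is stability under
all of `Gal(E/F)`** (Arthur–Clozel, Ch. 3, Thm. 4.2: "`E/F` is cyclic of prime degree `l`",
`σ` a generator; `|Gal(E/F)| = [E : F]` is prime, Mathlib `IsGalois.card_aut_eq_finrank`, so any
`σ ≠ 1` generates, `mem_powers_of_prime_card`, and the stabiliser of `Π` is a subgroup,
`isGalStable_pow`). [cite: ArthurClozelAMS120, Ch. 3, Thm. 4.2] -/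
theorem CuspidalAutomorphicRepGL.forall_isGalStable_of_prime [FiniteDimensional F E] [IsGalois F E]
    (hℓ : (Module.finrank F E).Prime) {P : CuspidalAutomorphicRepGL n E μ}
    {hμ : IsGalInvariant F μ} {σ : E ≃ₐ[F] E} (hσ : σ ≠ 1) (h : P.IsGalStable F hμ σ)
    (τ : E ≃ₐ[F] E) : P.IsGalStable F hμ τ := by
  haveI : Fact (Module.finrank F E).Prime := ⟨hℓ⟩
  obtain ⟨k, rfl⟩ := (Submonoid.mem_powers_iff τ σ).mp
    (mem_powers_of_prime_card (IsGalois.card_aut_eq_finrank F E) hσ)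
  exact CuspidalAutomorphicRepGL.isGalStable_pow F h k

/-- For `E/F` Galois of prime degree and `σ ≠ 1`: `Π` is stable under all of `Gal(E/F)` iff it is
`σ`-stable. [cite: ArthurClozelAMS120, Ch. 3, Thm. 4.2] -/
theorem CuspidalAutomorphicRepGL.forall_isGalStable_iff_of_prime [FiniteDimensional F E]
    [IsGalois F E] (hℓ : (Module.finrank F E).Prime) (P : CuspidalAutomorphicRepGL n E μ)
    (hμ : IsGalInvariant F μ) {σ : E ≃ₐ[F] E} (hσ : σ ≠ 1) :
    (∀ τ : E ≃ₐ[F] E, P.IsGalStable F hμ τ) ↔ P.IsGalStable F hμ σ :=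
  ⟨fun hall => hall σ, fun h => CuspidalAutomorphicRepGL.forall_isGalStable_of_prime F hℓ hσ h⟩

end PrimeDegree

/-! ### Thm. 4.2 (d), existence, with the printed hypothesis "`Π ≅ Π ∘ σ`, `σ` a generator" -/

section Descent

variable {n : ℕ} {F E : Type} [Field F] [NumberField F] [Field E] [NumberField E] [Algebra F E]

/-- **Arthur–Clozel, Ch. 3, Thm. 4.2 (d), existence half, in its printed form** (granted the named
fact `ArthurClozel1989_exists_cuspidal_descent_of_isGalStable`): for `E/F` Galois of prime degree
`ℓ` (hence cyclic, any `σ ≠ 1` generating `Gal(E/F)`) and `Π` a cuspidal automorphic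
representation of `GL_n(𝔸_E)` with `Π^σ = Π` for *one* non-trivial `σ` ("Assume `Π` is cuspidal,
`Π ≅ Π ∘ σ`. Then there is `π` cuspidal lifting to `Π`"), there is a cuspidal automorphic
representation `π` of `GL_n(𝔸_F)` of which `Π` is a weak base-change lift (Def. 1.1). Reduction
to the all-`σ` form by `forall_isGalStable_of_prime`.
[cite: ArthurClozelAMS120, Ch. 3, Thm. 4.2 (d)] -/
theorem ArthurClozel1989_exists_cuspidal_descent_of_isGalStable.of_generator
    (h : ArthurClozel1989_exists_cuspidal_descent_of_isGalStable (n := n) (F := F) (E := E))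
    [IsGalois F E] (hℓ : (Module.finrank F E).Prime)
    (ν : Measure (gl n E).automorphicQuotient) [(gl n E).IsAutomorphicMeasure ν]
    (hν : IsGalInvariant F ν) (Q : CuspidalAutomorphicRepGL n E ν) {σ : E ≃ₐ[F] E} (hσ : σ ≠ 1)
    (hQ : Q.IsGalStable F hν σ) :
    ∃ (μ : Measure (gl n F).automorphicQuotient) (_ : (gl n F).IsAutomorphicMeasure μ)
      (P : CuspidalAutomorphicRepGL n F μ), IsWeakBaseChangeLift P.1 Q.1 := by
  haveI : FiniteDimensional F E := Module.finite_of_finrank_pos hℓ.pos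
  exact h hℓ ν hν Q (CuspidalAutomorphicRepGL.forall_isGalStable_of_prime F hℓ hσ hQ)

end Descent

/-! ### The degenerate rank `n = 0` -/

section RankZero

variable (K : Type) [Field K] [NumberField K]

/-- The automorphic quotient `GL_0(𝔸_K) ⧸ A_G GL_0(K)` is one point: `GL_0(𝔸_K)`, the units of
the ring of `0 × 0` matrices, is the trivial group. (A `private` copy of the lemma of the same name
in `StrongMultiplicityOneRankinSelberg`, whose Rankin–Selberg imports are not wanted here.)
[folklore] -/
private theorem subsingleton_automorphicQuotient_gl_zero' :
    Subsingleton (gl 0 K).automorphicQuotient := by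
  haveI : Subsingleton (gl 0 K).Adelic :=
    inferInstanceAs (Subsingleton (GL (Fin 0) (AdeleRing (𝓞 K) K)))
  refine ⟨fun a b => ?_⟩
  obtain ⟨x, rfl⟩ := QuotientGroup.mk_surjective a
  obtain ⟨y, rfl⟩ := QuotientGroup.mk_surjective b
  rw [Subsingleton.elim x y]

/-- On the one-point automorphic quotient of `GL_0` the Dirac mass is an automorphic measure
(finite, positive on the non-empty open set, inner regular, invariant). [folklore] -/
theorem isAutomorphicMeasure_dirac_gl_zero (x : (gl 0 K).automorphicQuotient) :
    (gl 0 K).IsAutomorphicMeasure (Measure.dirac x) := by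
  haveI := subsingleton_automorphicQuotient_gl_zero' K
  exact
    { measure_univ_lt_top := measure_lt_top _ _
      open_pos := fun U _ hU => by
        rw [Subsingleton.eq_univ_of_nonempty hU, measure_univ]
        exact one_ne_zero
      innerRegular := fun U _ r hr => ⟨U, Set.Subset.rfl, (Set.toFinite U).isCompact, hr⟩
      measure_preimage_smul := fun c s _ => by
        rw [show (fun y : (gl 0 K).automorphicQuotient => c • y) ⁻¹' s = s from
          Set.ext fun y => by rw [Set.mem_preimage, Subsingleton.elim (c • y) y]] }

variable {K}

/-- On a one-point measure space an `L²` class which is non-zero has non-zero value at the point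
(its representative is the constant function with that value; cf.
`Lp_exists_eq_smul_of_subsingleton` of `StrongMultiplicityOneRankinSelberg`). [folklore] -/
private theorem Lp_apply_ne_zero_of_subsingleton {X : Type*} [MeasurableSpace X] [Subsingleton X]
    {μ : Measure X} (x₀ : X) {v : Lp ℂ 2 μ} (hv : v ≠ 0) : (v : X → ℂ) x₀ ≠ 0 := by
  intro h0
  apply hv
  rw [Lp.eq_zero_iff_ae_eq_zero]
  exact Filter.Eventually.of_forall fun y => by rw [Pi.zero_apply, Subsingleton.elim y x₀, h0]

/-- On a one-point measure space `L²` is a line: every class is a multiple of any class with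
non-zero value at the point. [folklore] -/
private theorem Lp_smul_eq_of_subsingleton {X : Type*} [MeasurableSpace X] [Subsingleton X]
    {μ : Measure X} (x₀ : X) (u v : Lp ℂ 2 μ) (hv : (v : X → ℂ) x₀ ≠ 0) :
    ((u : X → ℂ) x₀ / (v : X → ℂ) x₀) • v = u := by
  refine Lp.ext ?_
  filter_upwards [Lp.coeFn_smul ((u : X → ℂ) x₀ / (v : X → ℂ) x₀) v] with y hy
  rw [hy, Pi.smul_apply, smul_eq_mul, Subsingleton.elim y x₀, div_mul_cancel₀ _ hv]

variable (K)

/-- **`L²(GL_0(𝔸_K) ⧸ A_G GL_0(K))` is a cuspidal automorphic representation of the trivial group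
`GL_0(𝔸_K)`**, for any automorphic measure: every `L²` class is the class of a continuous
function (the quotient is one point), the cuspidality condition along `P_k`, `0 < k < 0`, is
empty, so `L²_cusp = L²`; and `L²` is a line (`Lp_smul_eq_of_subsingleton`; it is non-zero because
an automorphic measure charges the whole space), hence topologically irreducible. The degenerate
case `n = 0` of the tree's `CuspidalAutomorphicRepGL`. [folklore] -/
theorem nonempty_cuspidalAutomorphicRepGL_zero (μ : Measure (gl 0 K).automorphicQuotient)
    [(gl 0 K).IsAutomorphicMeasure μ] : Nonempty (CuspidalAutomorphicRepGL 0 K μ) := by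
  haveI := subsingleton_automorphicQuotient_gl_zero' K
  set x₀ : (gl 0 K).automorphicQuotient := (gl 0 K).toAutomorphicQuotient 1
  -- `L²_cusp = L²`
  have htop : (⊤ : ContRepresentation.ClosedSubrep ((gl 0 K).rightRegular μ)) ≤
      cuspidalSubspace 0 K μ := by
    intro f _
    refine Submodule.le_topologicalClosure _ ⟨⟨(f : (gl 0 K).automorphicQuotient → ℂ), ?_⟩, ?_⟩
    · exact ⟨continuous_of_const fun a b => by rw [Subsingleton.elim a b], Lp.memLp f,
        fun k _ hk => (Nat.not_lt_zero k hk).elim⟩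
    · rw [cuspFormsToLp_apply]
      exact Lp.toLp_coeFn f _
  -- a non-zero vector: the class of the constant function `1`
  haveI : Nonempty (gl 0 K).automorphicQuotient := ⟨x₀⟩
  have hμ0 : μ ≠ 0 := fun h => isOpen_univ.measure_ne_zero μ Set.univ_nonempty (by simp [h])
  set f₁ : (gl 0 K).L2 μ := (memLp_const (1 : ℂ)).toLp (fun _ => (1 : ℂ))
  have hf₁ : f₁ ≠ 0 := by
    intro h
    have h1 : (fun _ : (gl 0 K).automorphicQuotient => (1 : ℂ)) =ᵐ[μ] 0 :=
      (memLp_const (1 : ℂ)).coeFn_toLp.symm.trans (Lp.eq_zero_iff_ae_eq_zero.mp h)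
    haveI : (ae μ).NeBot := ae_neBot.mpr hμ0
    obtain ⟨y, hy⟩ := h1.exists
    exact one_ne_zero hy
  refine ⟨⟨⊤, htop, ?_⟩⟩
  rw [ContRepresentation.isTopIrreducible_iff]
  refine ⟨⟨⟨⟨f₁, trivial⟩, 0, fun h => hf₁ (congrArg Subtype.val h)⟩⟩, fun W => ?_⟩
  by_cases hW : ∃ v ∈ W, v ≠ 0
  · -- `W` contains a non-zero vector, hence the whole line
    right
    obtain ⟨v, hvW, hv0⟩ := hW
    have hvx : ((v : (gl 0 K).L2 μ) : (gl 0 K).automorphicQuotient → ℂ) x₀ ≠ 0 :=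
      Lp_apply_ne_zero_of_subsingleton x₀ fun h => hv0 (Subtype.ext h)
    refine ContRepresentation.ClosedSubrep.ext fun u => ⟨fun _ => trivial, fun _ => ?_⟩
    have hu : u = (((u : (gl 0 K).L2 μ) : (gl 0 K).automorphicQuotient → ℂ) x₀ /
        ((v : (gl 0 K).L2 μ) : (gl 0 K).automorphicQuotient → ℂ) x₀) • v :=
      Subtype.ext (Lp_smul_eq_of_subsingleton x₀ _ _ hvx).symm
    rw [hu]
    exact W.toSubmodule.smul_mem _ hvW
  · -- otherwise `W = ⊥`
    left
    push Not at hW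
    refine ContRepresentation.ClosedSubrep.ext fun u => ⟨fun hu => ?_, fun hu => ?_⟩
    · rw [ContRepresentation.ClosedSubrep.mem_bot]
      exact hW u hu
    · rw [ContRepresentation.ClosedSubrep.mem_bot] at hu
      rw [hu]
      exact W.toSubmodule.zero_mem

variable {K}
variable {F E : Type} [Field F] [NumberField F] [Field E] [NumberField E] [Algebra F E]

/-- For `n = 0` relation (1.1) is empty: Satake parameters of `GL_0` have `0` entries, so any
closed subrepresentation over `E` is a weak base-change lift of any one over `F`. [folklore] -/
theorem isWeakBaseChangeLift_of_rank_zero {μ : Measure (gl 0 F).automorphicQuotient}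
    [SMulInvariantMeasure (gl 0 F).Adelic (gl 0 F).automorphicQuotient μ]
    {ν : Measure (gl 0 E).automorphicQuotient}
    [SMulInvariantMeasure (gl 0 E).Adelic (gl 0 E).automorphicQuotient ν]
    (W : ContRepresentation.ClosedSubrep ((gl 0 F).rightRegular μ))
    (W' : ContRepresentation.ClosedSubrep ((gl 0 E).rightRegular ν)) :
    IsWeakBaseChangeLift W W' := by
  intro 𝔫 𝔑
  refine Filter.Eventually.of_forall fun w ϖ ϖ' α β hα hβ => ?_
  rw [Multiset.card_eq_zero.mp hα.card_eq, Multiset.card_eq_zero.mp hβ.card_eq, Multiset.map_zero]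

/-- **The fact `ArthurClozel1989_exists_cuspidal_descent_of_isGalStable` at `n = 0`, proved**: the
descended representation is `L²` of the one-point quotient of `GL_0(𝔸_F)` with its Dirac mass
(`nonempty_cuspidalAutomorphicRepGL_zero`, `isAutomorphicMeasure_dirac_gl_zero`), and (1.1) is
empty (`isWeakBaseChangeLift_of_rank_zero`). (Arthur–Clozel's `G = GL(n)` has `n ≥ 1`; the tree's
rendering quantifies over all `n`.) [cite: ArthurClozelAMS120, Ch. 3, Thm. 4.2 (d)] -/
theorem arthurClozel1989_exists_cuspidal_descent_of_isGalStable_zero :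
    ArthurClozel1989_exists_cuspidal_descent_of_isGalStable (n := 0) (F := F) (E := E) := by
  intro _ _ ν' _ _ Q _
  haveI := isAutomorphicMeasure_dirac_gl_zero F ((gl 0 F).toAutomorphicQuotient 1)
  obtain ⟨P⟩ := nonempty_cuspidalAutomorphicRepGL_zero F
    (Measure.dirac ((gl 0 F).toAutomorphicQuotient 1))
  exact ⟨_, ‹_›, P, isWeakBaseChangeLift_of_rank_zero P.1 Q.1⟩

/-- **Thm. 4.2 (d) with `η` ⇒ its `η`-free existence half, for every `n`.** The named fact
`ArthurClozel1989_exists_cuspidal_descent_of_isGalStable` of `AutomorphicGaloisConj` follows from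
the `η`-refined rendering `ArthurClozel1989_cuspidal_descent` of Thm. 4.2 (d) (`n ≥ 1`) together
with class field theory (`exists_isClassFieldCharacter`): for `n ≥ 1` this is
`arthurClozel1989_exists_cuspidal_descent_of_isGalStable_of_descent` of `ArthurClozelBaseChange`,
and `n = 0` is `arthurClozel1989_exists_cuspidal_descent_of_isGalStable_zero`.
[cite: ArthurClozelAMS120, Ch. 3, Thm. 4.2 (d)] -/
theorem arthurClozel1989_exists_cuspidal_descent_of_isGalStable_of_descent' {n : ℕ}
    [FiniteDimensional F E] (hCFT : exists_isClassFieldCharacter (F := F) (E := E))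
    (hd : ArthurClozel1989_cuspidal_descent n F E) :
    ArthurClozel1989_exists_cuspidal_descent_of_isGalStable (n := n) (F := F) (E := E) := by
  rcases Nat.eq_zero_or_pos n with rfl | hn
  · exact arthurClozel1989_exists_cuspidal_descent_of_isGalStable_zero
  · exact arthurClozel1989_exists_cuspidal_descent_of_isGalStable_of_descent hn hCFT hd

end RankZero

end Literature.NumberTheory.Automorphic
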